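import Literature.MathematicalPhysics.QuantumFieldTheory.Balaban1983to89.B9Thm311FormGapOfRegYP335AtLettersY
import Literature.MathematicalPhysics.QuantumFieldTheory.Balaban1983to89.Node00.OpsYSectDQ

/-!
# `Balaban1983to89.B9Thm311PosDefAveragingSwap` — T. Bałaban, *Propagators for lattice gauge theories in a background field*, Commun. Math. Phys. **99**
# (1985) 389–434 [Balaban1985BackgroundPropagators], THEOREM 3.11 p. 416 («`Δ_a` is positive definite») IS STABLE UNDER A RE-PINNING OF THE AVERAGING
# LETTER: `Δ_a^𝔮(U) = Δ(U) + D_UR(U)D*_U + 𝔮*a𝔮` (3.26) stays positive definite for ANY averaging pair `(𝔮, 𝔮*)` that is adjoint for the trace pairings,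
# ℓ²-bounded and ℓ²-CLOSE to the straight-contour `Q(U)` of (3.12), wherever `Δ_a^Q(U)` has a form gap — row 17 of the N06 certificate at the knit letter

statement-level skeleton of published theorems with citation tags; proofs where landed; nothing here is a claim about the Yang–Mills mass gap

THE PRINT.  (3.26) p. 395: `Δ_a(U) = Δ(U) + D_UR(U)D*_U + Q*(U)aQ(U)`; (3.12)–(3.14) p. 393: the averaging `Q(U)` (an average of parallel transports along
contours) and its adjoint `Q*(U)` (3.13); Thm 3.11 p. 416: `Δ_a` positive definite on the class (3.35); [5] = Bałaban, *Averaging operations for lattice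
gauge theories*, CMP **98** (1985), (15)–(23) pp. 19–21 and (120)–(124) p. 36: the composite (knit) averaging whose linearisation `Q_k(U)` coincides with the
straight-contour `Q(U)` at `U = 1` and differs from it at a curved background by the holonomy defect of the block paths.

WHY THIS FILE (cell `pub-ymgap`, node N06, seat `dag-n06-j` = bundle F5 rows 15–17, harness re-seat gen 35; director-ym ruling №375 «R2-A», 2026-08-30,
node00-def-Y's STEP (3) `Node00/OpsYSectDQ`).  The v10 record of the N06 certificate makes the averaging letter a PARAMETER `𝔮` (instances: today's
`qYOfRecord = QY parBY`, and the knit letter `qKnitOfRecord = QknitY` of dag-n06-l, for which (3.115) holds); among the nine re-pinned letters is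
`Δ_a^𝔮 = deltaAQY i 𝔮 𝔮s parS Gp U := hessY i U + gradY i U ∘ₗ RY i parS Gp U ∘ₗ divY i U + 𝔮s U ∘ₗ aY i ∘ₗ 𝔮 U` (def-Y's shape word, bus l. 18538), so
row 17 `hΔA : PosDefTr 1 (Δ_a(U))` at `𝔮 := qKnitOfRecord` is a NEW face.  Today's derivations of row 17 (`row17_of_row19_letters₂`, this lineage's
`B9Thm311PosDefOfRegYP335AtLettersY`) bottom out in cell `lit-balaban`'s Thm 3.3∕3.10 chain, which is specific to the KERNEL STRUCTURE of `QY` (a transport-lift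
`trLiftY qK qT`) and does not transfer to the knit letter by name.  THIS FILE gives the cheap honest road: PERTURBATION.  As quadratic forms
`⟨A, Δ_a^𝔮A⟩₁ − ⟨A, Δ_a^QA⟩₁ = ‖𝔮A‖²_w − ‖QA‖²_w` (by (3.13) for both pairs and `⟨Φ, aΦ⟩₁ = ‖Φ‖²_w`), which is `≤ δ(K+K′)·‖A‖²` in modulus when the two
letters are ℓ²-bounded by `K, K′` and ℓ²-close by `δ`; so a form gap `γ` of `Δ_a^Q` (this lineage's `B9Thm311FormGapOfRegYP335AtLettersY` ✓-pending, Thm 3.11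
WITH A CONSTANT at section-carrying members) survives as positive definiteness of `Δ_a^𝔮` once `δ(K+K′) < γ`.  Written AGAINST SECTION VARIABLES: the pair
enters through its VALUES `Q := 𝔮 U`, `Qs := 𝔮s U` (plain linear maps), and `Δ_a^𝔮(U)` is spelled out with def-Y's association, so `deltaAQY i 𝔮 𝔮s parS Gp U`
unfolds to it by `rfl` and every theorem here applies to the v10 letter by `exact`.

WHAT IS PROVED (sorry-free; 0 `def`).
* §1 (abstract, any weighted trace pairing): `posDefTr_of_formGap_of_abs_sub_le` (a form gap `γ` in a weight `wgt > 0` plus a perturbation of modulus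
  `≤ β·⟨A,A⟩_wgt`, `β < γ` ⟹ `PosDefTr`); `abs_self_sub_self_le_of_sq_le` (`|‖X‖²_w − ‖Y‖²_w| ≤ δ(k_X + k_Y)·n` from `‖X‖²_w ≤ k_X²n`, `‖Y‖²_w ≤ k_Y²n`,
  `‖X − Y‖²_w ≤ δ²n` — the real inner product space `realify311`; the polarisation step is the tree's
  `Literature.Analysis.FluidPDE.abs_norm_sq_sub_norm_sq_le_norm_sub_mul`, inlined).
* §2 (def-Y's letters, an abstract pair `(Q, Qs)`): `deltaA_swap_apply` (`Δ_a^𝔮 = Δ_a^{parB} − Q*_{parB}aQ_{parB} + Qs∘a∘Q`, by `rfl`-unfolding (3.26));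
  ★ `trIP_deltaA_swap_sub` (the form identity above, `G`-valued data, `G ≤ U(N)`); ★ `trIP_deltaA_swap_abs_sub_le` (its modulus bound from the three ℓ²
  binders); `deltaA_swap_isSymmTr` (`Δ_a^𝔮` is `⟨·,·⟩₁`-symmetric when `(Q,Qs)` is an adjoint pair — (L3) of def-Y's `QLawsY`);
  ★★ `posDefTr_deltaA_swap_of_formGap` (form gap of `Δ_a^{parB}` in any weight `wgt > 0` + the three ℓ² binders + `δ(K+K′) < γ` ⟹ `PosDefTr 1 Δ_a^𝔮`).
* §3 ★★★ `posDefTr_deltaA_swap_of_regYP335_section` — ROW 17 AT ANY ADJOINT AVERAGING PAIR, on print's class (3.35) at def-Y's site transporter of record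
  `parSymY`, at every SECTION-CARRYING member above one threshold: `∃ M₁ a₁ γ > 0` (those of `formGap_deltaAY_of_regYP335_section`) such that for `β` onto,
  `M₁ ≦ M`, `0 < α₀`, `M·α₀ ≦ a₁`, `U ∈ (bg9YP … x).Reg335 c₃₅ α₀`, and every pair `(Q, Qs)` adjoint at unit weights whose ℓ²(w)-size `K`, together with the
  size `K′` of `QY parBY U` and their ℓ²-distance `δ` in the scale weight `c_f²(L^{lev b})⁻²`, satisfies `δ(K+K′) < γ`:
  `PosDefTr 1 (hessY U + D_U R D*_U + Qs ∘ a ∘ Q)`.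
* §4 AT def-Y's v10 LETTER BY NAME (`Node00.deltaAQY`, ✓ `Node00/OpsYSectDQ`): `deltaAQY_GpPhysY` (print-units vs lattice `G′` in the `R` slot),
  `deltaAQY_isSymmTr`, ★★ `posDefTr_deltaAQY_of_formGap`, ★★★ `posDefTr_deltaAQY_of_regYP335_section` ∕ `posDefTr_deltaAQY_at_scMemberY` — §2∕§3 read at
  `Q := 𝔮 U`, `Qs := 𝔮s U` (definitional unfolding, `exact`).
HONEST SHAPE (director-ym №375 Q2).  At `𝔮 := qKnitOfRecord` row 17 becomes «DERIVED at section-carrying members MODULO displayed ℓ² binders»: the size `K`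
of the knit letter in `ℓ²(c_f²L^{−2lev}) → ℓ²(w)` (an ℓ² form of dag-n06-c's (L7)) and — the one ESTIMATE — its ℓ²-CLOSENESS `δ(Mα₀)` to `QY parBY` on the
class, small with `Mα₀` (the holonomy-defect smallness of the block paths; the same object R2-A's (L6) «onto by Neumann» needs; owner dag-n06-l ∕ J-B
lineage).  Nothing of Thm 3.3∕3.10 at the knit letter is claimed; inner-corner members are not covered (other lanes); NOT a node discharge; count-neutral;
nothing continuum ∕ OS ∕ mass gap ∕ Clay.  No `sorry`, no `axiom`, no `instance`, no `notation`, no `def`.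
-/

noncomputable section

namespace Literature.MathematicalPhysics.QuantumFieldTheory.Balaban1983to89.B9Thm311PosDefAveragingSwap

open Literature.MathematicalPhysics.QuantumFieldTheory.Balaban1983to89
open B9Thm311ReadingCoords B9Thm39ReadingCoords B9Thm39ReadingAtLetters Node00
open B6KLevelCensusIndexV1 B6Ineq2142KLevelV1 B6GlobalChartV1 B9PinMembersKLevelV1 B9PinGeometryKLevelV1 B9GeoNormsKLevelV1
  B9BackgroundsKLevelV1 B9BackgroundsKLevelV1P B9Thm34Ext
open B9Thm311FormGapOfRegYP335AtLettersY
open Literature.MathematicalPhysics.QuantumFieldTheory.Balaban1983to89.B9Thm311DeltaPrimePos (trIP_add_right trIP_self_nonneg trIP_self_pos)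
open Literature.MathematicalPhysics.QuantumFieldTheory.Balaban1983to89.B9Eq3132CoerciveVariational (trIP_sub_right)
open Literature.MathematicalPhysics.QuantumFieldTheory.Balaban1983to89.B9Ineq349SiteAdjoint (trIP_comm)
open Literature.MathematicalPhysics.QuantumFieldTheory.Balaban1983to89.B9Thm311ProjectionR (trIP_aY_eq RY_parSymY_isSymmTr)
open Literature.MathematicalPhysics.QuantumFieldTheory.Balaban1983to89.Node00 (deltaAQY RY_GpPhysY)
open Literature.MathematicalPhysics.QuantumFieldTheory.Balaban1983to89.B9Thm311AdjointPairs (isAdjTr_QY_QsY isAdjTr_QY_QsY_parBY isAdjTr_gradY_divY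
  isSymmTr_sandwich_of_isAdjTr isSymmTr_QsY_aY_QY aK_isSymm isSymmTr_sub)
open Literature.MathematicalPhysics.QuantumFieldTheory.Balaban1983to89.B9Thm311DeltaPrimeSymm (isSymmTr_add)
open Literature.MathematicalPhysics.QuantumFieldTheory.Balaban1983to89.B9Thm311InputsAtOne (isSymmTr_liftOpY)
open Literature.MathematicalPhysics.QuantumFieldTheory.Balaban1983to89.B9Thm311PosViaLocalInversesY (deltaAY_parSymY_isSymmTr)
open Literature.MathematicalPhysics.QuantumFieldTheory.Balaban1983to89.B9SectionCarryingMembersV1 (SCMemberY)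
open scoped InnerProductSpace

/-! ## §1 Abstract: a form gap survives a form-small perturbation; the polarisation bound for `‖X‖² − ‖Y‖²` -/

section Abstract

open scoped Matrix.Norms.L2Operator

variable {S S' : Type} [Fintype S] [Fintype S'] {N : ℕ}

/-- **A FORM GAP SURVIVES A FORM-SMALL PERTURBATION**: if `γ·⟨A,A⟩_wgt ≤ ⟨A, TA⟩_w` and `|⟨A, T′A⟩_w − ⟨A, TA⟩_w| ≤ β·⟨A,A⟩_wgt` for all `A`, with `β < γ` and
`wgt > 0`, then `T′` is positive definite for `⟨·,·⟩_w`. [cite: Balaban1985BackgroundPropagators, Thm 3.11 p.416 («positive definite»), bookkeeping] -/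
theorem posDefTr_of_formGap_of_abs_sub_le {w wgt : S → ℝ} (hwgt : ∀ s, 0 < wgt s)
    {T T' : (S → Matrix (Fin N) (Fin N) ℂ) →ₗ[ℂ] (S → Matrix (Fin N) (Fin N) ℂ)} {γ β : ℝ}
    (hgap : ∀ A, γ * trIP wgt A A ≤ trIP w A (T A))
    (hpert : ∀ A, |trIP w A (T' A) - trIP w A (T A)| ≤ β * trIP wgt A A) (hβγ : β < γ) : PosDefTr w T' := by
  intro A hA
  have hpos : 0 < trIP wgt A A := trIP_self_pos wgt hwgt hA
  have h1 := hgap A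
  have h2 := (abs_le.1 (hpert A)).1
  have h3 : 0 < (γ - β) * trIP wgt A A := mul_pos (by linarith) hpos
  nlinarith

/-- **`|‖X‖²_w − ‖Y‖²_w| ≤ δ·(k_X + k_Y)·n`** whenever `‖X‖²_w ≤ k_X²·n`, `‖Y‖²_w ≤ k_Y²·n` and `‖X − Y‖²_w ≤ δ²·n` (`w > 0`; `k_X, k_Y, δ, n ≥ 0`) — the weighted
trace pairing is a real inner product in this lineage's orthonormal chart `realify311`. [cite: Balaban1985BackgroundPropagators, p.393 (scalar products), bookkeeping] -/
theorem abs_self_sub_self_le_of_sq_le {w : S' → ℝ} (hw : ∀ s, 0 < w s) (X Y : S' → Matrix (Fin N) (Fin N) ℂ) {n kX kY δ : ℝ}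
    (hn : 0 ≤ n) (hkX : 0 ≤ kX) (hkY : 0 ≤ kY) (hδ : 0 ≤ δ)
    (hX : trIP w X X ≤ kX ^ 2 * n) (hY : trIP w Y Y ≤ kY ^ 2 * n) (hXY : trIP w (X - Y) (X - Y) ≤ δ ^ 2 * n) :
    |trIP w X X - trIP w Y Y| ≤ δ * (kX + kY) * n := by
  have eX : trIP w X X = ‖realify311 w hw X‖ ^ 2 := (norm_sq_realify311 (hw := hw) X).symm
  have eY : trIP w Y Y = ‖realify311 w hw Y‖ ^ 2 := (norm_sq_realify311 (hw := hw) Y).symm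
  have eXY : trIP w (X - Y) (X - Y) = ‖realify311 w hw X - realify311 w hw Y‖ ^ 2 := by
    rw [← map_sub, norm_sq_realify311 (hw := hw)]
  have hs : 0 ≤ Real.sqrt n := Real.sqrt_nonneg n
  have bound : ∀ {v : EuclideanSpace ℝ (Idx311 S' (Fin N))} {k : ℝ}, 0 ≤ k → ‖v‖ ^ 2 ≤ k ^ 2 * n → ‖v‖ ≤ k * Real.sqrt n := by
    intro v k hk h
    have h1 : ‖v‖ ≤ Real.sqrt (k ^ 2 * n) := (Real.le_sqrt (norm_nonneg _) (by positivity)).2 h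
    rwa [Real.sqrt_mul (sq_nonneg k), Real.sqrt_sq hk] at h1
  have bX := bound hkX (eX ▸ hX)
  have bY := bound hkY (eY ▸ hY)
  have bXY := bound hδ (eXY ▸ hXY)
  rw [eX, eY]
  -- the polarisation bound `|‖x‖² − ‖y‖²| ≤ ‖x − y‖·(‖x‖ + ‖y‖)` (the tree's `Literature.Analysis.FluidPDE.abs_norm_sq_sub_norm_sq_le_norm_sub_mul`, inlined
  -- to keep this module's imports inside the Bałaban chapter)
  have hpol : ∀ x y : EuclideanSpace ℝ (Idx311 S' (Fin N)), |‖x‖ ^ 2 - ‖y‖ ^ 2| ≤ ‖x - y‖ * (‖x‖ + ‖y‖) := by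
    intro x y
    have h : ‖x‖ ^ 2 - ‖y‖ ^ 2 = (‖x‖ - ‖y‖) * (‖x‖ + ‖y‖) := by ring
    rw [h, abs_mul, abs_of_nonneg (by positivity : (0 : ℝ) ≤ ‖x‖ + ‖y‖)]
    exact mul_le_mul_of_nonneg_right (abs_norm_sub_norm_le x y) (by positivity)
  refine (hpol _ _).trans ?_
  calc ‖realify311 w hw X - realify311 w hw Y‖ * (‖realify311 w hw X‖ + ‖realify311 w hw Y‖)
      ≤ (δ * Real.sqrt n) * (kX * Real.sqrt n + kY * Real.sqrt n) :=
        mul_le_mul bXY (add_le_add bX bY) (by positivity) (by positivity)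
    _ = δ * (kX + kY) * (Real.sqrt n ^ 2) := by ring
    _ = δ * (kX + kY) * n := by rw [Real.sq_sqrt hn]

end Abstract

/-! ## §2 `Δ_a` with the averaging pair as a parameter: the swap identity, its form, its bound, symmetry, positivity transfer -/

section Letters

open scoped Matrix.Norms.L2Operator

variable {d ℓ : ℕ} {hd : 1 ≤ d + 1} {hL : Odd (ℓ + 1) ∧ 1 < ℓ + 1} {b₀ b₁ : ℝ} {N : ℕ}
variable (i : KIdx d ℓ hd hL b₀ b₁) {G : Subgroup (Matrix (Fin N) (Fin N) ℂ)ˣ}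

/-- **THE SWAP IDENTITY** (unfolding (3.26)): `Δ(U) + D_UR D*_U + Qs∘a∘Q = Δ_a^{parB}(U) − Q*_{parB}(U)aQ_{parB}(U) + Qs∘a∘Q`, pointwise.
[cite: Balaban1985BackgroundPropagators, (3.26) p.395] -/
theorem deltaA_swap_apply (parS : SiteParY (Matrix (Fin N) (Fin N) ℂ) i) (parB : BondParY (Matrix (Fin N) (Fin N) ℂ) i)
    (Gp : SiteOpY (Matrix (Fin N) (Fin N) ℂ) i) (U : CfgY (Matrix (Fin N) (Fin N) ℂ) i)
    (Q : (FBondY i → Matrix (Fin N) (Fin N) ℂ) →ₗ[ℂ] (IBondY i → Matrix (Fin N) (Fin N) ℂ))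
    (Qs : (IBondY i → Matrix (Fin N) (Fin N) ℂ) →ₗ[ℂ] (FBondY i → Matrix (Fin N) (Fin N) ℂ)) (A : FBondY i → Matrix (Fin N) (Fin N) ℂ) :
    (hessY i U + gradY i U ∘ₗ RY i parS Gp U ∘ₗ divY i U + Qs ∘ₗ aY i ∘ₗ Q) A
      = deltaAY i parS parB Gp U A - (QsY i parB U ∘ₗ aY i ∘ₗ QY i parB U) A + (Qs ∘ₗ aY i ∘ₗ Q) A := by
  simp only [deltaAY, LinearMap.add_apply]
  abel

/-- ★ **THE SWAP AS QUADRATIC FORMS**: for a `G`-valued configuration (`G ≤ U(N)`), a `G`-valued contour table `parB` and a pair `(Q, Qs)` adjoint for the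
unit-weight trace pairings, `⟨A, Δ_a^𝔮A⟩₁ − ⟨A, Δ_a^{parB}A⟩₁ = ‖QA‖²_w − ‖Q_{parB}(U)A‖²_w` (`w` = def-Y's averaging weights, `⟨Φ, aΦ⟩₁ = ‖Φ‖²_w`).
[cite: Balaban1985BackgroundPropagators, (3.26) p.395, (3.13) p.393] -/
theorem trIP_deltaA_swap_sub (hG : G ≤ B7Prop2Explicit.unitaryUnits (Matrix (Fin N) (Fin N) ℂ))
    (parS : SiteParY (Matrix (Fin N) (Fin N) ℂ) i) {parB : BondParY (Matrix (Fin N) (Fin N) ℂ) i} (Gp : SiteOpY (Matrix (Fin N) (Fin N) ℂ) i)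
    {U : CfgY (Matrix (Fin N) (Fin N) ℂ) i} (hpar : ∀ s s', parB U s s' ∈ G)
    {Q : (FBondY i → Matrix (Fin N) (Fin N) ℂ) →ₗ[ℂ] (IBondY i → Matrix (Fin N) (Fin N) ℂ)}
    {Qs : (IBondY i → Matrix (Fin N) (Fin N) ℂ) →ₗ[ℂ] (FBondY i → Matrix (Fin N) (Fin N) ℂ)}
    (hQ : IsAdjTr (fun _ => (1 : ℝ)) (fun _ => (1 : ℝ)) Q Qs) (A : FBondY i → Matrix (Fin N) (Fin N) ℂ) :
    trIP (fun _ => (1 : ℝ)) A ((hessY i U + gradY i U ∘ₗ RY i parS Gp U ∘ₗ divY i U + Qs ∘ₗ aY i ∘ₗ Q) A)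
        - trIP (fun _ => (1 : ℝ)) A (deltaAY i parS parB Gp U A)
      = trIP i.w (Q A) (Q A) - trIP i.w (QY i parB U A) (QY i parB U A) := by
  rw [deltaA_swap_apply, trIP_add_right, trIP_sub_right]
  have h1 : trIP (fun _ => (1 : ℝ)) A ((QsY i parB U ∘ₗ aY i ∘ₗ QY i parB U) A) = trIP i.w (QY i parB U A) (QY i parB U A) := by
    rw [LinearMap.comp_apply, LinearMap.comp_apply, ← isAdjTr_QY_QsY i hG parB U hpar, trIP_aY_eq]
  have h2 : trIP (fun _ => (1 : ℝ)) A ((Qs ∘ₗ aY i ∘ₗ Q) A) = trIP i.w (Q A) (Q A) := by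
    rw [LinearMap.comp_apply, LinearMap.comp_apply, ← hQ, trIP_aY_eq]
  rw [h1, h2]
  ring

/-- ★ **THE MODULUS BOUND**: with ℓ²-SIZE binders `‖QA‖²_w ≤ K²⟨A,A⟩_wgt`, `‖Q_{parB}(U)A‖²_w ≤ K′²⟨A,A⟩_wgt` and the ℓ²-CLOSENESS binder
`‖(Q − Q_{parB}(U))A‖²_w ≤ δ²⟨A,A⟩_wgt` (any weight `wgt > 0` on fine bonds): `|⟨A, Δ_a^𝔮A⟩₁ − ⟨A, Δ_a^{parB}A⟩₁| ≤ δ(K+K′)·⟨A,A⟩_wgt`.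
[cite: Balaban1985BackgroundPropagators, (3.26) p.395, (3.13) p.393, (3.15) p.393] -/
theorem trIP_deltaA_swap_abs_sub_le (hG : G ≤ B7Prop2Explicit.unitaryUnits (Matrix (Fin N) (Fin N) ℂ))
    (parS : SiteParY (Matrix (Fin N) (Fin N) ℂ) i) {parB : BondParY (Matrix (Fin N) (Fin N) ℂ) i} (Gp : SiteOpY (Matrix (Fin N) (Fin N) ℂ) i)
    {U : CfgY (Matrix (Fin N) (Fin N) ℂ) i} (hpar : ∀ s s', parB U s s' ∈ G)
    {Q : (FBondY i → Matrix (Fin N) (Fin N) ℂ) →ₗ[ℂ] (IBondY i → Matrix (Fin N) (Fin N) ℂ)}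
    {Qs : (IBondY i → Matrix (Fin N) (Fin N) ℂ) →ₗ[ℂ] (FBondY i → Matrix (Fin N) (Fin N) ℂ)}
    (hQ : IsAdjTr (fun _ => (1 : ℝ)) (fun _ => (1 : ℝ)) Q Qs) {wgt : FBondY i → ℝ} (hwgt : ∀ b, 0 < wgt b)
    {K K' δ : ℝ} (hK : 0 ≤ K) (hK' : 0 ≤ K') (hδ : 0 ≤ δ)
    (hsize : ∀ A, trIP i.w (Q A) (Q A) ≤ K ^ 2 * trIP wgt A A)
    (hsizeY : ∀ A, trIP i.w (QY i parB U A) (QY i parB U A) ≤ K' ^ 2 * trIP wgt A A)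
    (hclose : ∀ A, trIP i.w ((Q - QY i parB U) A) ((Q - QY i parB U) A) ≤ δ ^ 2 * trIP wgt A A)
    (A : FBondY i → Matrix (Fin N) (Fin N) ℂ) :
    |trIP (fun _ => (1 : ℝ)) A ((hessY i U + gradY i U ∘ₗ RY i parS Gp U ∘ₗ divY i U + Qs ∘ₗ aY i ∘ₗ Q) A)
        - trIP (fun _ => (1 : ℝ)) A (deltaAY i parS parB Gp U A)| ≤ δ * (K + K') * trIP wgt A A := by
  rw [trIP_deltaA_swap_sub i hG parS Gp hpar hQ A]
  have hXY : trIP i.w (Q A - QY i parB U A) (Q A - QY i parB U A) ≤ δ ^ 2 * trIP wgt A A := by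
    have h := hclose A
    rwa [LinearMap.sub_apply] at h
  exact abs_self_sub_self_le_of_sq_le i.hw (Q A) (QY i parB U A) (trIP_self_nonneg wgt hwgt A) hK hK' hδ (hsize A) (hsizeY A) hXY

/-- **`Δ_a^𝔮(U)` IS `⟨·,·⟩₁`-SYMMETRIC** at a `G`-valued configuration (`G ≤ U(N)`), at def-Y's site transporter of record `parSymY`, whenever `(Q, Qs)` is an
adjoint pair for the unit-weight trace pairings ((L3) of def-Y's `QLawsY`): the three summands `Δ(U)`, `D_UR(U)D*_U` (an adjoint sandwich of the symmetric `R`)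
and `Qs∘a∘Q` (an adjoint sandwich of the symmetric weight `a`) are symmetric. [cite: Balaban1985BackgroundPropagators, (3.26) p.395, Thm 3.11 p.416 («It is a symmetric … operator»)] -/
theorem deltaA_swap_isSymmTr (hG : G ≤ B7Prop2Explicit.unitaryUnits (Matrix (Fin N) (Fin N) ℂ))
    {U : CfgY (Matrix (Fin N) (Fin N) ℂ) i} (hU : ∀ μ x, U μ x ∈ G)
    {Q : (FBondY i → Matrix (Fin N) (Fin N) ℂ) →ₗ[ℂ] (IBondY i → Matrix (Fin N) (Fin N) ℂ)}
    {Qs : (IBondY i → Matrix (Fin N) (Fin N) ℂ) →ₗ[ℂ] (FBondY i → Matrix (Fin N) (Fin N) ℂ)}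
    (hQ : IsAdjTr (fun _ => (1 : ℝ)) (fun _ => (1 : ℝ)) Q Qs) :
    IsSymmTr (fun _ => (1 : ℝ))
      (hessY i U + gradY i U ∘ₗ RY i (parSymY i) (GpY i (parSymY i)) U ∘ₗ divY i U + Qs ∘ₗ aY i ∘ₗ Q) := by
  have hY := deltaAY_parSymY_isSymmTr i hG hU
  have hQQ : IsSymmTr (fun _ => (1 : ℝ)) (QsY i (parBY i) U ∘ₗ aY i ∘ₗ QY i (parBY i) U) :=
    isSymmTr_QsY_aY_QY i hG (parBY i) U (fun s s' => parBY_mem i hU s s') (aK_isSymm i)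
  have hq : IsSymmTr (fun _ => (1 : ℝ)) (Qs ∘ₗ aY i ∘ₗ Q) := isSymmTr_sandwich_of_isAdjTr hQ (isSymmTr_liftOpY (aK i) (aK_isSymm i))
  have hsum := isSymmTr_add (fun _ => (1 : ℝ)) (isSymmTr_sub hY hQQ) hq
  have heq : deltaAY i (parSymY i) (parBY i) (GpY i (parSymY i)) U - QsY i (parBY i) U ∘ₗ aY i ∘ₗ QY i (parBY i) U + Qs ∘ₗ aY i ∘ₗ Q
      = hessY i U + gradY i U ∘ₗ RY i (parSymY i) (GpY i (parSymY i)) U ∘ₗ divY i U + Qs ∘ₗ aY i ∘ₗ Q := by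
    simp only [deltaAY]
    abel
  rw [heq] at hsum
  exact hsum

/-- ★★ **POSITIVITY TRANSFER**: a form gap `γ·⟨A,A⟩_wgt ≤ ⟨A, Δ_a^{parB}(U)A⟩₁` of the straight-contour `Δ_a` in some weight `wgt > 0`, the three ℓ² binders
(sizes `K, K′`, closeness `δ`) and `δ(K+K′) < γ` give `PosDefTr 1 (Δ_a^𝔮(U))` for the swapped averaging pair. [cite: Balaban1985BackgroundPropagators, Thm 3.11 p.416, (3.26) p.395] -/
theorem posDefTr_deltaA_swap_of_formGap (hG : G ≤ B7Prop2Explicit.unitaryUnits (Matrix (Fin N) (Fin N) ℂ))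
    (parS : SiteParY (Matrix (Fin N) (Fin N) ℂ) i) {parB : BondParY (Matrix (Fin N) (Fin N) ℂ) i} (Gp : SiteOpY (Matrix (Fin N) (Fin N) ℂ) i)
    {U : CfgY (Matrix (Fin N) (Fin N) ℂ) i} (hpar : ∀ s s', parB U s s' ∈ G)
    {Q : (FBondY i → Matrix (Fin N) (Fin N) ℂ) →ₗ[ℂ] (IBondY i → Matrix (Fin N) (Fin N) ℂ)}
    {Qs : (IBondY i → Matrix (Fin N) (Fin N) ℂ) →ₗ[ℂ] (FBondY i → Matrix (Fin N) (Fin N) ℂ)}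
    (hQ : IsAdjTr (fun _ => (1 : ℝ)) (fun _ => (1 : ℝ)) Q Qs) {wgt : FBondY i → ℝ} (hwgt : ∀ b, 0 < wgt b)
    {γ K K' δ : ℝ} (hK : 0 ≤ K) (hK' : 0 ≤ K') (hδ : 0 ≤ δ)
    (hgap : ∀ A, γ * trIP wgt A A ≤ trIP (fun _ => (1 : ℝ)) A (deltaAY i parS parB Gp U A))
    (hsize : ∀ A, trIP i.w (Q A) (Q A) ≤ K ^ 2 * trIP wgt A A)
    (hsizeY : ∀ A, trIP i.w (QY i parB U A) (QY i parB U A) ≤ K' ^ 2 * trIP wgt A A)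
    (hclose : ∀ A, trIP i.w ((Q - QY i parB U) A) ((Q - QY i parB U) A) ≤ δ ^ 2 * trIP wgt A A) (hβ : δ * (K + K') < γ) :
    PosDefTr (fun _ => (1 : ℝ)) (hessY i U + gradY i U ∘ₗ RY i parS Gp U ∘ₗ divY i U + Qs ∘ₗ aY i ∘ₗ Q) :=
  posDefTr_of_formGap_of_abs_sub_le hwgt hgap
    (fun A => trIP_deltaA_swap_abs_sub_le i hG parS Gp hpar hQ hwgt hK hK' hδ hsize hsizeY hclose A) hβ

end Letters

/-! ## §3 ★★★ Row 17 at ANY adjoint averaging pair, on print's class at section-carrying members -/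

section Record

open scoped Matrix.Norms.L2Operator
open B7Prop2SpecialUnitary

variable {N : ℕ} (θ : Stage3Params) (Mstar : ℕ)

/-- ★★★ **ROW 17 AT ANY ADJOINT AVERAGING PAIR** — THEOREM 3.11 FOR THE RE-PINNED `Δ_a^𝔮` ON PRINT's CLASS (3.35), AT def-Y's SITE TRANSPORTER OF RECORD, FOR
EVERY SECTION-CARRYING MEMBER ABOVE ONE THRESHOLD, MODULO THE ℓ² BINDERS: there are `M₁, a₁, γ > 0` such that for every member `x` with `β` onto, `M₁ ≦ M`, every
`α₀ > 0` with `M·α₀ ≦ a₁`, every `SU(N)`-valued `U ∈ (bg9YP … x).Reg335 c₃₅ α₀`, and every pair `(Q, Qs)` adjoint for the unit-weight trace pairings whose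
ℓ²-size `K`, the size `K′` of `QY parBY U` and their ℓ²-distance `δ` — all measured from the scale weight `c_f²(L^{lev b})⁻²` into the averaging weight `w` —
satisfy `δ(K+K′) < γ`: `PosDefTr 1 (Δ(U) + D_UR(U)D*_U + Qs∘a∘Q)`.  (`γ` is the constant of `formGap_deltaAY_of_regYP335_section`; at def-Y's
`deltaAQY x.toKIdx 𝔮 𝔮s (parSymY _) (GpY _ (parSymY _)) U` take `Q := 𝔮 _ U`, `Qs := 𝔮s _ U` — the statement unfolds by `rfl`.)
[cite: Balaban1985BackgroundPropagators, Thm 3.11 p.416; Thm 3.3 p.399; (3.26) p.395; (3.13), (3.15) p.393; (3.69) p.404] -/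
theorem posDefTr_deltaA_swap_of_regYP335_section (hN : 1 ≤ N) :
    ∃ M₁ a₁ γ : ℝ, 0 < M₁ ∧ 0 < a₁ ∧ 0 < γ ∧
    ∀ (x : MemberY θ.d₆ θ.ℓ₆ θ.hd' θ.hL' θ.b₀ θ.b₁ Mstar), Function.Surjective (β x.hN x.D x.hk) → M₁ ≤ (geo9Y x).M →
      ∀ α₀ : ℝ, 0 < α₀ → (geo9Y x).M * α₀ ≤ a₁ →
      ∀ U : CfgY (Matrix (Fin N) (Fin N) ℂ) x.toKIdx,
        (bg9YP (Matrix (Fin N) (Fin N) ℂ) (specialUnitaryUnits (Fin N)) x).Reg335 c35Y α₀ U →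
        ∀ (Q : (FBondY x.toKIdx → Matrix (Fin N) (Fin N) ℂ) →ₗ[ℂ] (IBondY x.toKIdx → Matrix (Fin N) (Fin N) ℂ))
          (Qs : (IBondY x.toKIdx → Matrix (Fin N) (Fin N) ℂ) →ₗ[ℂ] (FBondY x.toKIdx → Matrix (Fin N) (Fin N) ℂ)),
          IsAdjTr (fun _ => (1 : ℝ)) (fun _ => (1 : ℝ)) Q Qs →
        ∀ K K' δ : ℝ, 0 ≤ K → 0 ≤ K' → 0 ≤ δ →
          (∀ A, trIP x.toKIdx.w (Q A) (Q A)
              ≤ K ^ 2 * ∑ b, (x.toKIdx.cf ^ 2 * ((((θ.ℓ₆ : ℝ) + 1) ^ levV1 x.toKIdx b.src)⁻¹) ^ 2) * ∑ a, ∑ c, ‖A b a c‖ ^ 2) →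
          (∀ A, trIP x.toKIdx.w (QY x.toKIdx (parBY x.toKIdx) U A) (QY x.toKIdx (parBY x.toKIdx) U A)
              ≤ K' ^ 2 * ∑ b, (x.toKIdx.cf ^ 2 * ((((θ.ℓ₆ : ℝ) + 1) ^ levV1 x.toKIdx b.src)⁻¹) ^ 2) * ∑ a, ∑ c, ‖A b a c‖ ^ 2) →
          (∀ A, trIP x.toKIdx.w ((Q - QY x.toKIdx (parBY x.toKIdx) U) A) ((Q - QY x.toKIdx (parBY x.toKIdx) U) A)
              ≤ δ ^ 2 * ∑ b, (x.toKIdx.cf ^ 2 * ((((θ.ℓ₆ : ℝ) + 1) ^ levV1 x.toKIdx b.src)⁻¹) ^ 2) * ∑ a, ∑ c, ‖A b a c‖ ^ 2) →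
          δ * (K + K') < γ →
          PosDefTr (fun _ => (1 : ℝ))
            (hessY x.toKIdx U + gradY x.toKIdx U ∘ₗ RY x.toKIdx (parSymY x.toKIdx) (GpY x.toKIdx (parSymY x.toKIdx)) U ∘ₗ divY x.toKIdx U
              + Qs ∘ₗ aY x.toKIdx ∘ₗ Q) := by
  obtain ⟨M₁, a₁, γ, hM₁, ha₁, hγ, h⟩ := formGap_deltaAY_of_regYP335_section (N := N) θ Mstar hN
  refine ⟨M₁, a₁, γ, hM₁, ha₁, hγ, fun x hsurj hM α₀ hα ha U hU Q Qs hQ K K' δ hK hK' hδ hsize hsizeY hclose hβ => ?_⟩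
  have hG : specialUnitaryUnits (Fin N) ≤ B7Prop2Explicit.unitaryUnits (Matrix (Fin N) (Fin N) ℂ) := specialUnitaryUnits_le_unitaryUnits
  have hUG : ∀ μ z, U μ z ∈ specialUnitaryUnits (Fin N) := hU.1.1
  have hwgt : ∀ b : FBondY x.toKIdx, 0 < x.toKIdx.cf ^ 2 * ((((θ.ℓ₆ : ℝ) + 1) ^ levV1 x.toKIdx b.src)⁻¹) ^ 2 := by
    intro b
    have hcf : x.toKIdx.cf ≠ 0 := x.toKIdx.hcf
    have hL : (0 : ℝ) < ((θ.ℓ₆ : ℝ) + 1) ^ levV1 x.toKIdx b.src := pow_pos (by positivity) _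
    positivity
  have hwsum : ∀ A : FBondY x.toKIdx → Matrix (Fin N) (Fin N) ℂ,
      trIP (fun b => x.toKIdx.cf ^ 2 * ((((θ.ℓ₆ : ℝ) + 1) ^ levV1 x.toKIdx b.src)⁻¹) ^ 2) A A
        = ∑ b, (x.toKIdx.cf ^ 2 * ((((θ.ℓ₆ : ℝ) + 1) ^ levV1 x.toKIdx b.src)⁻¹) ^ 2) * ∑ a, ∑ c, ‖A b a c‖ ^ 2 :=
    fun A => B9Thm311FlippedBondForms.trIP_self_eq_sum _ A
  refine posDefTr_deltaA_swap_of_formGap x.toKIdx hG (parSymY x.toKIdx) (GpY x.toKIdx (parSymY x.toKIdx))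
    (fun s s' => parBY_mem x.toKIdx hUG s s') hQ hwgt hK hK' hδ (fun A => ?_) (fun A => ?_) (fun A => ?_) (fun A => ?_) hβ
  · rw [hwsum]; exact h x hsurj hM α₀ hα ha U hU A
  · rw [hwsum]; exact hsize A
  · rw [hwsum]; exact hsizeY A
  · rw [hwsum]; exact hclose A

end Record


/-! ## §4 At def-Y's v10 letter `Node00.deltaAQY` BY NAME (№375 R2-A step (3), `Node00/OpsYSectDQ` ✓) -/

section AtDeltaAQY

open scoped Matrix.Norms.L2Operator
open B7Prop2SpecialUnitary

variable {d ℓ : ℕ} {hd : 1 ≤ d + 1} {hL : Odd (ℓ + 1) ∧ 1 < ℓ + 1} {b₀ b₁ : ℝ} {N : ℕ}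
variable (i : KIdx d ℓ hd hL b₀ b₁) {G : Subgroup (Matrix (Fin N) (Fin N) ℂ)ˣ}

/-- `Δ_a^𝔮` with print-units `G′_phys = η²G′` in the `R` slot IS `Δ_a^𝔮` with the lattice `G′` (`R` is scale-free: def-Y's `RY_GpPhysY`).
[cite: Balaban1985BackgroundPropagators, (3.26) p.395, (3.25) p.394] -/
theorem deltaAQY_GpPhysY (𝔮 : CfgY (Matrix (Fin N) (Fin N) ℂ) i → ((FBondY i → Matrix (Fin N) (Fin N) ℂ) →ₗ[ℂ] (IBondY i → Matrix (Fin N) (Fin N) ℂ)))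
    (𝔮s : CfgY (Matrix (Fin N) (Fin N) ℂ) i → ((IBondY i → Matrix (Fin N) (Fin N) ℂ) →ₗ[ℂ] (FBondY i → Matrix (Fin N) (Fin N) ℂ)))
    (parS : SiteParY (Matrix (Fin N) (Fin N) ℂ) i) (U : CfgY (Matrix (Fin N) (Fin N) ℂ) i) :
    deltaAQY i 𝔮 𝔮s parS (GpPhysY i parS) U = deltaAQY i 𝔮 𝔮s parS (GpY i parS) U := by
  simp only [deltaAQY, RY_GpPhysY]

/-- **`deltaAQY` IS `⟨·,·⟩₁`-SYMMETRIC** at a `G`-valued configuration (`G ≤ U(N)`), site transporter `parSymY`, for an adjoint pair ((L3) `IsAdjOnQ` read at `U`).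
[cite: Balaban1985BackgroundPropagators, (3.26) p.395, Thm 3.11 p.416 («It is a symmetric … operator»)] -/
theorem deltaAQY_isSymmTr (hG : G ≤ B7Prop2Explicit.unitaryUnits (Matrix (Fin N) (Fin N) ℂ))
    {U : CfgY (Matrix (Fin N) (Fin N) ℂ) i} (hU : ∀ μ x, U μ x ∈ G)
    {𝔮 : CfgY (Matrix (Fin N) (Fin N) ℂ) i → ((FBondY i → Matrix (Fin N) (Fin N) ℂ) →ₗ[ℂ] (IBondY i → Matrix (Fin N) (Fin N) ℂ))}
    {𝔮s : CfgY (Matrix (Fin N) (Fin N) ℂ) i → ((IBondY i → Matrix (Fin N) (Fin N) ℂ) →ₗ[ℂ] (FBondY i → Matrix (Fin N) (Fin N) ℂ))}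
    (hQ : IsAdjTr (fun _ => (1 : ℝ)) (fun _ => (1 : ℝ)) (𝔮 U) (𝔮s U)) :
    IsSymmTr (fun _ => (1 : ℝ)) (deltaAQY i 𝔮 𝔮s (parSymY i) (GpY i (parSymY i)) U) :=
  deltaA_swap_isSymmTr i hG hU hQ

/-- ★★ **POSITIVITY TRANSFER AT `deltaAQY`**: a form gap of the straight-contour `Δ_a` in a weight `wgt > 0`, the three ℓ² binders and `δ(K+K′) < γ` give
`PosDefTr 1 (deltaAQY i 𝔮 𝔮s parS Gp U)`. [cite: Balaban1985BackgroundPropagators, Thm 3.11 p.416, (3.26) p.395] -/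
theorem posDefTr_deltaAQY_of_formGap (hG : G ≤ B7Prop2Explicit.unitaryUnits (Matrix (Fin N) (Fin N) ℂ))
    (parS : SiteParY (Matrix (Fin N) (Fin N) ℂ) i) {parB : BondParY (Matrix (Fin N) (Fin N) ℂ) i} (Gp : SiteOpY (Matrix (Fin N) (Fin N) ℂ) i)
    {U : CfgY (Matrix (Fin N) (Fin N) ℂ) i} (hpar : ∀ s s', parB U s s' ∈ G)
    {𝔮 : CfgY (Matrix (Fin N) (Fin N) ℂ) i → ((FBondY i → Matrix (Fin N) (Fin N) ℂ) →ₗ[ℂ] (IBondY i → Matrix (Fin N) (Fin N) ℂ))}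
    {𝔮s : CfgY (Matrix (Fin N) (Fin N) ℂ) i → ((IBondY i → Matrix (Fin N) (Fin N) ℂ) →ₗ[ℂ] (FBondY i → Matrix (Fin N) (Fin N) ℂ))}
    (hQ : IsAdjTr (fun _ => (1 : ℝ)) (fun _ => (1 : ℝ)) (𝔮 U) (𝔮s U)) {wgt : FBondY i → ℝ} (hwgt : ∀ b, 0 < wgt b)
    {γ K K' δ : ℝ} (hK : 0 ≤ K) (hK' : 0 ≤ K') (hδ : 0 ≤ δ)
    (hgap : ∀ A, γ * trIP wgt A A ≤ trIP (fun _ => (1 : ℝ)) A (deltaAY i parS parB Gp U A))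
    (hsize : ∀ A, trIP i.w (𝔮 U A) (𝔮 U A) ≤ K ^ 2 * trIP wgt A A)
    (hsizeY : ∀ A, trIP i.w (QY i parB U A) (QY i parB U A) ≤ K' ^ 2 * trIP wgt A A)
    (hclose : ∀ A, trIP i.w ((𝔮 U - QY i parB U) A) ((𝔮 U - QY i parB U) A) ≤ δ ^ 2 * trIP wgt A A) (hβ : δ * (K + K') < γ) :
    PosDefTr (fun _ => (1 : ℝ)) (deltaAQY i 𝔮 𝔮s parS Gp U) :=
  posDefTr_deltaA_swap_of_formGap i hG parS Gp hpar hQ hwgt hK hK' hδ hgap hsize hsizeY hclose hβ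

variable (θ : Stage3Params) (Mstar : ℕ)

/-- ★★★ **ROW 17 AT THE v10 LETTER `deltaAQY … (parSymY) (GpY parSymY)` FOR ANY ADJOINT AVERAGING FAMILY**, on print's class (3.35) at section-carrying
members above one threshold, modulo the ℓ² binders (sizes `K, K′`, closeness `δ`, `δ(K+K′) < γ`) — §3 read at def-Y's letter (a v10 record's family
`𝔮 : ∀ i, CfgY 𝔸 i → …` is read here at the member's index as `𝔮 x.toKIdx`). [cite: Balaban1985BackgroundPropagators, Thm 3.11 p.416; Thm 3.3 p.399; (3.26) p.395] -/
theorem posDefTr_deltaAQY_of_regYP335_section (hN : 1 ≤ N) :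
    ∃ M₁ a₁ γ : ℝ, 0 < M₁ ∧ 0 < a₁ ∧ 0 < γ ∧
    ∀ (x : MemberY θ.d₆ θ.ℓ₆ θ.hd' θ.hL' θ.b₀ θ.b₁ Mstar), Function.Surjective (β x.hN x.D x.hk) → M₁ ≤ (geo9Y x).M →
      ∀ α₀ : ℝ, 0 < α₀ → (geo9Y x).M * α₀ ≤ a₁ →
      ∀ U : CfgY (Matrix (Fin N) (Fin N) ℂ) x.toKIdx,
        (bg9YP (Matrix (Fin N) (Fin N) ℂ) (specialUnitaryUnits (Fin N)) x).Reg335 c35Y α₀ U →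
        ∀ (𝔮 : CfgY (Matrix (Fin N) (Fin N) ℂ) x.toKIdx →
              ((FBondY x.toKIdx → Matrix (Fin N) (Fin N) ℂ) →ₗ[ℂ] (IBondY x.toKIdx → Matrix (Fin N) (Fin N) ℂ)))
          (𝔮s : CfgY (Matrix (Fin N) (Fin N) ℂ) x.toKIdx →
              ((IBondY x.toKIdx → Matrix (Fin N) (Fin N) ℂ) →ₗ[ℂ] (FBondY x.toKIdx → Matrix (Fin N) (Fin N) ℂ))),
          IsAdjTr (fun _ => (1 : ℝ)) (fun _ => (1 : ℝ)) (𝔮 U) (𝔮s U) →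
        ∀ K K' δ : ℝ, 0 ≤ K → 0 ≤ K' → 0 ≤ δ →
          (∀ A, trIP x.toKIdx.w (𝔮 U A) (𝔮 U A)
              ≤ K ^ 2 * ∑ b, (x.toKIdx.cf ^ 2 * ((((θ.ℓ₆ : ℝ) + 1) ^ levV1 x.toKIdx b.src)⁻¹) ^ 2) * ∑ a, ∑ c, ‖A b a c‖ ^ 2) →
          (∀ A, trIP x.toKIdx.w (QY x.toKIdx (parBY x.toKIdx) U A) (QY x.toKIdx (parBY x.toKIdx) U A)
              ≤ K' ^ 2 * ∑ b, (x.toKIdx.cf ^ 2 * ((((θ.ℓ₆ : ℝ) + 1) ^ levV1 x.toKIdx b.src)⁻¹) ^ 2) * ∑ a, ∑ c, ‖A b a c‖ ^ 2) →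
          (∀ A, trIP x.toKIdx.w ((𝔮 U - QY x.toKIdx (parBY x.toKIdx) U) A) ((𝔮 U - QY x.toKIdx (parBY x.toKIdx) U) A)
              ≤ δ ^ 2 * ∑ b, (x.toKIdx.cf ^ 2 * ((((θ.ℓ₆ : ℝ) + 1) ^ levV1 x.toKIdx b.src)⁻¹) ^ 2) * ∑ a, ∑ c, ‖A b a c‖ ^ 2) →
          δ * (K + K') < γ →
          PosDefTr (fun _ => (1 : ℝ)) (deltaAQY x.toKIdx 𝔮 𝔮s (parSymY x.toKIdx) (GpY x.toKIdx (parSymY x.toKIdx)) U) := by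
  obtain ⟨M₁, a₁, γ, hM₁, ha₁, hγ, h⟩ := posDefTr_deltaA_swap_of_regYP335_section (N := N) θ Mstar hN
  exact ⟨M₁, a₁, γ, hM₁, ha₁, hγ, fun x hsurj hM α₀ hα ha U hU 𝔮 𝔮s hQ K K' δ hK hK' hδ hsize hsizeY hclose hβ =>
    h x hsurj hM α₀ hα ha U hU (𝔮 U) (𝔮s U) hQ K K' δ hK hK' hδ hsize hsizeY hclose hβ⟩

/-- ★★★ **THE SAME AT `SCMemberY` BY NAME** (n06-c's carrier of section-carrying members). [cite: Balaban1985BackgroundPropagators, Thm 3.11 p.416; Balaban1984PropagatorsII, (2.45) p.231] -/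
theorem posDefTr_deltaAQY_at_scMemberY (hN : 1 ≤ N) :
    ∃ M₁ a₁ γ : ℝ, 0 < M₁ ∧ 0 < a₁ ∧ 0 < γ ∧
    ∀ (j : SCMemberY θ.d₆ θ.ℓ₆ θ.hd' θ.hL' θ.b₀ θ.b₁ Mstar), M₁ ≤ (geo9Y j.val).M →
      ∀ α₀ : ℝ, 0 < α₀ → (geo9Y j.val).M * α₀ ≤ a₁ →
      ∀ U : CfgY (Matrix (Fin N) (Fin N) ℂ) j.val.toKIdx,
        (bg9YP (Matrix (Fin N) (Fin N) ℂ) (specialUnitaryUnits (Fin N)) j.val).Reg335 c35Y α₀ U →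
        ∀ (𝔮 : CfgY (Matrix (Fin N) (Fin N) ℂ) j.val.toKIdx →
              ((FBondY j.val.toKIdx → Matrix (Fin N) (Fin N) ℂ) →ₗ[ℂ] (IBondY j.val.toKIdx → Matrix (Fin N) (Fin N) ℂ)))
          (𝔮s : CfgY (Matrix (Fin N) (Fin N) ℂ) j.val.toKIdx →
              ((IBondY j.val.toKIdx → Matrix (Fin N) (Fin N) ℂ) →ₗ[ℂ] (FBondY j.val.toKIdx → Matrix (Fin N) (Fin N) ℂ))),
          IsAdjTr (fun _ => (1 : ℝ)) (fun _ => (1 : ℝ)) (𝔮 U) (𝔮s U) →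
        ∀ K K' δ : ℝ, 0 ≤ K → 0 ≤ K' → 0 ≤ δ →
          (∀ A, trIP j.val.toKIdx.w (𝔮 U A) (𝔮 U A)
              ≤ K ^ 2 * ∑ b, (j.val.toKIdx.cf ^ 2 * ((((θ.ℓ₆ : ℝ) + 1) ^ levV1 j.val.toKIdx b.src)⁻¹) ^ 2) * ∑ a, ∑ c, ‖A b a c‖ ^ 2) →
          (∀ A, trIP j.val.toKIdx.w (QY j.val.toKIdx (parBY j.val.toKIdx) U A) (QY j.val.toKIdx (parBY j.val.toKIdx) U A)
              ≤ K' ^ 2 * ∑ b, (j.val.toKIdx.cf ^ 2 * ((((θ.ℓ₆ : ℝ) + 1) ^ levV1 j.val.toKIdx b.src)⁻¹) ^ 2) * ∑ a, ∑ c, ‖A b a c‖ ^ 2) →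
          (∀ A, trIP j.val.toKIdx.w ((𝔮 U - QY j.val.toKIdx (parBY j.val.toKIdx) U) A) ((𝔮 U - QY j.val.toKIdx (parBY j.val.toKIdx) U) A)
              ≤ δ ^ 2 * ∑ b, (j.val.toKIdx.cf ^ 2 * ((((θ.ℓ₆ : ℝ) + 1) ^ levV1 j.val.toKIdx b.src)⁻¹) ^ 2) * ∑ a, ∑ c, ‖A b a c‖ ^ 2) →
          δ * (K + K') < γ →
          PosDefTr (fun _ => (1 : ℝ)) (deltaAQY j.val.toKIdx 𝔮 𝔮s (parSymY j.val.toKIdx) (GpY j.val.toKIdx (parSymY j.val.toKIdx)) U) := by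
  obtain ⟨M₁, a₁, γ, hM₁, ha₁, hγ, h⟩ := posDefTr_deltaAQY_of_regYP335_section (N := N) θ Mstar hN
  exact ⟨M₁, a₁, γ, hM₁, ha₁, hγ, fun j hM α₀ hα ha U hU 𝔮 𝔮s hQ K K' δ hK hK' hδ hsize hsizeY hclose hβ =>
    h j.val j.surjective_beta hM α₀ hα ha U hU 𝔮 𝔮s hQ K K' δ hK hK' hδ hsize hsizeY hclose hβ⟩

end AtDeltaAQY

end Literature.MathematicalPhysics.QuantumFieldTheory.Balaban1983to89.B9Thm311PosDefAveragingSwap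

end
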